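import Summits.Schanuel.Schanuel.Theorems.ZilberEacNearResonantElimination
import Summits.Schanuel.Schanuel.Theorems.ZilberEacNearResonantLimit
import Summits.Schanuel.Schanuel.Theorems.ZilberEacNearResonantExistence
import Summits.Schanuel.Schanuel.Theorems.ZilberEacRealHyperplaneDensity
import HarnessLib

/-!
# The CRITICAL-SIZE family of O54 (a) has Zariski dense exponential points:
# `{x₂ = r₀x₀ + (1 - r₀)x₁, yⱼ = xⱼ + y₂}`, `r₀ ∉ ℚ` — in particular `r₀ = √2`

Zilber's Exponential-Algebraic Closedness, case ladder (host summit Schanuel, cell `pub-schanuel`,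
seat 2, gen 13).  THE FAMILY (`r₀ ∈ ℝ ∖ ℚ`):

  `W_r = {x₂ = r₀x₀ + (1 - r₀)x₁,  y₀ = x₀ + y₂,  y₁ = x₁ + y₂} ⊆ ℂ³ × ℂ³`,

exponential points `e^{xⱼ} = xⱼ + e^{x₂}` (`j = 0, 1`).  In the dictionary of the earlier density
theorems this is the real hyperplane `Σ rᵢ xᵢ` with `Aⱼ = Xⱼ`, `Fⱼ = 1` and
`λ (1 + deg Fⱼ) = (r₀ + r₁) · 1 = 1 = deg Aⱼ`: the CRITICAL SIZE recorded as open in O53 (a) / O54 (a)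
(printed example `r = (√2, 1 - √2)`): the coupling `y₂ = e^{x₂}` has the same order as the targets
along every lattice ray, the moving-polydisc contraction has no relatively small perturbation to
work with, and THEOREMS J/L/L″/M/M₂ have no family to read.

**THEOREM (`unprojectedDense_polyFibredGraph_critical`).**  For every irrational `r₀`,
`I(W_r ∩ Γ_exp) = I(W_r)`.

Proof — a NEW regime, "near-resonant all-fast balance along the irrational real plane":
(1) `ZilberEacNearResonantLimit`: infinitely many admissible `σ` (`Re G̃(σ) = 0`), each a base point
of the rescaled system at a REAL defect `ε*`; (2) `ZilberEacNearResonantLabels`: labels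
`(n₁ + d, n₁)` with `r₀d + n₁ → ε*`, `d → ∞` (lattice points hugging the line `n₁ = -r₀d`);
(3) `ZilberEacNearResonantExistence`: implicit-function continuation gives honest solutions with
`x₂ ~ log d`, `x₀ ~ 2πi(1 - r₀)d`, `y₂ ~ d/σ`; (4) THEOREM N (`ZilberEacNearResonantElimination`):
a polynomial relation along `(log, lin, lin)` growth with infinitely many limit ratios `1/σ` is
trivial.

Corollaries: `polyFibredGraph_critical_member_dense` (all seven `ECCell 3 2` hypotheses, not
linearly split, `W ∩ Γ_exp ≠ ∅`, dense) and **`sqrtTwoOne_member_dense`**: O53 (a)'s printed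
critical example `{x₂ = √2x₀ + (1 - √2)x₁, y₀ = x₀ + y₂, y₁ = x₁ + y₂}` is a certified member of
`EC(3,2)` with ZARISKI DENSE exponential points.

HONEST FRAMING: explicit families inside an OPEN cell; the critical size with a hyperplane
constant `Re c ≠ 0`, non-constant fibres, and the super-critical sizes stay open; `EC(3,2)` OPEN;
NOT Schanuel's conjecture; EAC ⇏ SC.
-/

noncomputable section

open Complex MvPolynomial Filter Topology
open Literature.NumberTheory.Transcendental Literature.ModelTheory.Zilber
  Literature.ModelTheory.ExponentialFields

set_option linter.dupNamespace false

namespace Summit.Schanuel.Schanuel.Theorems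

section Critical

/-- **THEOREM (Zariski density at critical size).**  For irrational `r₀` the exponential points of
`W_r = {x₂ = r₀x₀ + (1 - r₀)x₁, y₀ = x₀ + y₂, y₁ = x₁ + y₂}` are Zariski dense:
`I(W_r ∩ Γ_exp) = I(W_r)`.  See the module docstring. (new)
[cite: MantovaMasser2023, §1 p.5 (the open case dim π(V) = 2 in ℂ³×ℂˣ³)] -/
theorem unprojectedDense_polyFibredGraph_critical (r₀ : ℝ) (hr : Irrational r₀) :
    UnprojectedDense (polyFibredGraph (hyperplanePoly ![r₀, 1 - r₀] 0) (fun j => X j)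
      (fun _ => (1 : Polynomial ℂ).toMvPolynomial 0)) := by
  classical
  have h0 : r₀ ≠ 0 := hr.ne_zero
  have h1 : r₀ ≠ 1 := hr.ne_one
  have hπ := Real.pi_pos
  -- (1) infinitely many admissible limit values
  obtain ⟨σ, hσinj, hσ⟩ := exists_admissible_seq r₀ h0 h1
  have h𝒯 : (Set.range fun m => (σ m)⁻¹).Infinite :=
    Set.infinite_range_of_injective fun m m' h => hσinj (inv_injective h)
  refine unprojectedDense_of_logLinLin (isIrreducibleClosed_polyFibredGraph _ _ _)
    (by rw [zariskiDim_polyFibredGraph])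
    ![Sum.inl (Fin.last 2), Sum.inl 0, Sum.inr (Fin.last 2)]
    (Wst := 2 * Real.pi * I * ((1 - r₀ : ℝ) : ℂ)) ?_ h𝒯 ?_
  · refine mul_ne_zero Complex.two_pi_I_ne_zero ?_
    rw [Ne, ofReal_eq_zero, sub_eq_zero]
    exact Ne.symm h1
  rintro _ ⟨m, rfl⟩
  obtain ⟨hσ0, hA₀, hA₁, hre⟩ := hσ m
  -- the base point and its real defect
  obtain ⟨he₀, he₁, hτ, hq⟩ := nrF_basePoint r₀ hσ0 hA₀ hA₁ hre
  -- (2) labels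
  obtain ⟨d, n₁, hd, hε⟩ := exists_labels_tendsto hr (-(nrG r₀ (σ m)).im / (2 * Real.pi))
  -- (3) solutions
  obtain ⟨x, hsol, hb, hc, hdl⟩ := exists_solutions_nearResonant r₀ h0 h1 hσ0
    (q := (log (1 + 2 * Real.pi * I * ((1 - r₀ : ℝ) : ℂ) * σ m),
      log (1 + -(2 * Real.pi * I * (r₀ : ℂ)) * σ m), -log (σ m))) he₀ he₁ hτ hq hd hε
  have hexpτ : exp (-log (σ m)) = (σ m)⁻¹ := by
    rw [Complex.exp_neg, Complex.exp_log hσ0]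
  rw [show ((log (1 + 2 * Real.pi * I * ((1 - r₀ : ℝ) : ℂ) * σ m),
      log (1 + -(2 * Real.pi * I * (r₀ : ℂ)) * σ m), -log (σ m)) : ℂ × ℂ × ℂ).2.2 = -log (σ m)
      by rfl, hexpτ] at hdl
  -- the points of `W ∩ Γ_exp`
  set r : Fin 2 → ℝ := ![r₀, 1 - r₀] with hrdef
  set P : ℕ → Fin 3 ⊕ Fin 3 → ℂ := fun k =>
    pgParam (hyperplanePoly r 0) (fun j => X j) (fun _ => (1 : Polynomial ℂ).toMvPolynomial 0)
      (x k) (exp (∑ i, (r i : ℂ) * x k i + 0)) with hP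
  refine ⟨P, fun k => Real.log (d k), fun k => (d k : ℝ), ?_, tendsto_log_natCast_comp hd,
    tendsto_natCast_atTop_atTop.comp hd, tendsto_log_pow_div_natCast_comp hd, ?_, ?_, ?_⟩
  · -- membership, eventually
    filter_upwards [hsol] with k hk
    refine ⟨pgParam_mem _ _ _ _ _,
      pgParam_hyperplane_mem_expGraph r 0 (fun j => X j) (fun _ => (1 : Polynomial ℂ)) fun j => ?_⟩
    rw [eval_X, Polynomial.eval_one, mul_one, add_zero]
    exact hk j
  · -- `x₂ / log d → 1`
    refine hb.congr fun k => ?_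
    simp only [hP, Matrix.cons_val_zero, pgParam_inl_last, eval_hyperplanePoly, ell, add_zero]
  · -- `x₀ / d → 2πi(1 - r₀)`
    refine hc.congr fun k => ?_
    have e : (Sum.inl 0 : Fin 3 ⊕ Fin 3) = Sum.inl (Fin.castSucc (0 : Fin 2)) := rfl
    simp only [hP, Matrix.cons_val_one, Matrix.cons_val_zero, e, pgParam_inl_castSucc]
    push_cast
    rfl
  · -- `y₂ / d → 1/σ`
    refine hdl.congr fun k => ?_
    simp only [hP, Matrix.cons_val_two, Matrix.tail_cons, Matrix.head_cons, pgParam_inr,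
      pMulParam_last, add_zero]
    push_cast
    rfl

/-- **Certified members of the open cell at critical size, dense.**  For irrational `r₀`:
all seven hypotheses of `ECCell 3 2` for `W_r`, not linearly split, `W_r ∩ Γ_exp ≠ ∅`,
`I(W_r ∩ Γ_exp) = I(W_r)`. (new)
[cite: MantovaMasser2023, §1 p.5 (the open case dim π(V) = 2 in ℂ³×ℂˣ³)] -/
theorem polyFibredGraph_critical_member_dense (r₀ : ℝ) (hr : Irrational r₀) :
    (IsIrreducibleClosed ℂ (polyFibredGraph (hyperplanePoly ![r₀, 1 - r₀] 0) (fun j => X j)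
        (fun _ => (1 : Polynomial ℂ).toMvPolynomial 0)) ∧
      (polyFibredGraph (hyperplanePoly ![r₀, 1 - r₀] 0) (fun j => X j)
          (fun _ => (1 : Polynomial ℂ).toMvPolynomial 0) ∩ torusLocus ℂ 3).Nonempty ∧
      IsRotund ℂ 3 (polyFibredGraph (hyperplanePoly ![r₀, 1 - r₀] 0) (fun j => X j)
          (fun _ => (1 : Polynomial ℂ).toMvPolynomial 0) ∩ torusLocus ℂ 3) ∧
      IsAddFree ℂ 3 (polyFibredGraph (hyperplanePoly ![r₀, 1 - r₀] 0) (fun j => X j)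
          (fun _ => (1 : Polynomial ℂ).toMvPolynomial 0) ∩ torusLocus ℂ 3) ∧
      IsMulFree ℂ 3 (polyFibredGraph (hyperplanePoly ![r₀, 1 - r₀] 0) (fun j => X j)
          (fun _ => (1 : Polynomial ℂ).toMvPolynomial 0) ∩ torusLocus ℂ 3) ∧
      zariskiDim ℂ (polyFibredGraph (hyperplanePoly ![r₀, 1 - r₀] 0) (fun j => X j)
          (fun _ => (1 : Polynomial ℂ).toMvPolynomial 0)) = (3 : ℕ) ∧
      addProjDim ℂ 3 (polyFibredGraph (hyperplanePoly ![r₀, 1 - r₀] 0) (fun j => X j)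
          (fun _ => (1 : Polynomial ℂ).toMvPolynomial 0)) = (2 : ℕ)) ∧
    ¬ IsLinearSplit ℂ 3 (polyFibredGraph (hyperplanePoly ![r₀, 1 - r₀] 0) (fun j => X j)
        (fun _ => (1 : Polynomial ℂ).toMvPolynomial 0)) ∧
    (polyFibredGraph (hyperplanePoly ![r₀, 1 - r₀] 0) (fun j => X j)
        (fun _ => (1 : Polynomial ℂ).toMvPolynomial 0) ∩ expGraph ℂ 3).Nonempty ∧
    UnprojectedDense (polyFibredGraph (hyperplanePoly ![r₀, 1 - r₀] 0) (fun j => X j)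
        (fun _ => (1 : Polynomial ℂ).toMvPolynomial 0)) := by
  have hA : Function.Injective (aeval (fun j : Fin 2 => (X j : MvPolynomial (Fin 2) ℂ)) :
      MvPolynomial (Fin 2) ℂ →ₐ[ℂ] MvPolynomial (Fin 2) ℂ) := by
    rw [aeval_X_left]; exact fun _ _ h => h
  have hirr : ∃ i : Fin 2, Irrational ((![r₀, 1 - r₀] : Fin 2 → ℝ) i) := ⟨0, by simpa using hr⟩
  have hcell := ecCell_hypotheses_polyFibredGraph_hyperplane ![r₀, 1 - r₀] 0 (fun j => X j)
    (fun _ => (1 : Polynomial ℂ).toMvPolynomial 0) hA hirr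
  have hdense := unprojectedDense_polyFibredGraph_critical r₀ hr
  refine ⟨hcell, not_isLinearSplit_polyFibredGraph _ (fun j => X j) _ (by norm_num) hA, ?_, hdense⟩
  obtain ⟨w, hw, -⟩ := hcell.2.1
  exact inter_expGraph_nonempty_of_vanishingIdeal_eq ⟨w, hw⟩ hdense

/-- **O53 (a)'s printed critical example is dense.**
`W = {x₂ = √2 x₀ + (1 - √2) x₁, y₀ = x₀ + y₂, y₁ = x₁ + y₂} ⊆ ℂ³ × ℂ³`
(`e^z = z + e^{√2 z + (1-√2) w}`, `e^w = w + e^{√2 z + (1-√2) w}`; `λ(1 + deg F) = deg A`, the critical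
size): all seven hypotheses of `ECCell 3 2`, not linearly split, `W ∩ Γ_exp ≠ ∅` AND
`I(W ∩ Γ_exp) = I(W)`. (new) [cite: MantovaMasser2023, §1 p.5 (the open case dim π(V) = 2 in ℂ³×ℂˣ³)] -/
theorem sqrtTwoOne_member_dense :
    (IsIrreducibleClosed ℂ (polyFibredGraph (hyperplanePoly ![Real.sqrt 2, 1 - Real.sqrt 2] 0)
        (fun j => X j) (fun _ => (1 : Polynomial ℂ).toMvPolynomial 0)) ∧
      (polyFibredGraph (hyperplanePoly ![Real.sqrt 2, 1 - Real.sqrt 2] 0) (fun j => X j)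
          (fun _ => (1 : Polynomial ℂ).toMvPolynomial 0) ∩ torusLocus ℂ 3).Nonempty ∧
      IsRotund ℂ 3 (polyFibredGraph (hyperplanePoly ![Real.sqrt 2, 1 - Real.sqrt 2] 0)
          (fun j => X j) (fun _ => (1 : Polynomial ℂ).toMvPolynomial 0) ∩ torusLocus ℂ 3) ∧
      IsAddFree ℂ 3 (polyFibredGraph (hyperplanePoly ![Real.sqrt 2, 1 - Real.sqrt 2] 0)
          (fun j => X j) (fun _ => (1 : Polynomial ℂ).toMvPolynomial 0) ∩ torusLocus ℂ 3) ∧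
      IsMulFree ℂ 3 (polyFibredGraph (hyperplanePoly ![Real.sqrt 2, 1 - Real.sqrt 2] 0)
          (fun j => X j) (fun _ => (1 : Polynomial ℂ).toMvPolynomial 0) ∩ torusLocus ℂ 3) ∧
      zariskiDim ℂ (polyFibredGraph (hyperplanePoly ![Real.sqrt 2, 1 - Real.sqrt 2] 0)
          (fun j => X j) (fun _ => (1 : Polynomial ℂ).toMvPolynomial 0)) = (3 : ℕ) ∧
      addProjDim ℂ 3 (polyFibredGraph (hyperplanePoly ![Real.sqrt 2, 1 - Real.sqrt 2] 0)
          (fun j => X j) (fun _ => (1 : Polynomial ℂ).toMvPolynomial 0)) = (2 : ℕ)) ∧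
    ¬ IsLinearSplit ℂ 3 (polyFibredGraph (hyperplanePoly ![Real.sqrt 2, 1 - Real.sqrt 2] 0)
        (fun j => X j) (fun _ => (1 : Polynomial ℂ).toMvPolynomial 0)) ∧
    (polyFibredGraph (hyperplanePoly ![Real.sqrt 2, 1 - Real.sqrt 2] 0) (fun j => X j)
        (fun _ => (1 : Polynomial ℂ).toMvPolynomial 0) ∩ expGraph ℂ 3).Nonempty ∧
    UnprojectedDense (polyFibredGraph (hyperplanePoly ![Real.sqrt 2, 1 - Real.sqrt 2] 0)
        (fun j => X j) (fun _ => (1 : Polynomial ℂ).toMvPolynomial 0)) :=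
  polyFibredGraph_critical_member_dense (Real.sqrt 2) irrational_sqrt_two

end Critical

end Summit.Schanuel.Schanuel.Theorems

end
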